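import Literature.NumberTheory.CubicFields.OrbitFiniteness
import Literature.NumberTheory.CubicFields.StabilizerFinite
import Literature.NumberTheory.CubicFields.ReducibleStabilizer
import Mathlib.NumberTheory.LSeries.Basic
import HarnessLib

/-!
# Shintani's zeta functions of binary cubic forms (BTT (11)–(12), (22)): the Dirichlet series and their coefficients

Topic `Literature/NumberTheory/CubicFields`; built on `OrbitFiniteness.lean` (for `D ≠ 0` there
are finitely many `GL₂(ℤ)`-orbits of discriminant `D`; `classNumber D = h(D)`) and
`DeloneFaddeevAutomorphisms.lean` (`Stab_{GL₂(ℤ)}(f) ≅ Aut(R(f))`).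

Bhargava–Taniguchi–Thorne 2023, §2.4: "Shintani's zeta functions associated to the space of
binary cubic forms are defined as follows:
`ξ^±(s) := Σ_{x ∈ GL₂(ℤ)\V(ℤ), ±Disc(x) > 0} |Stab(x)|⁻¹ |Disc(x)|^{-s}` (11) … more generally, for a
`GL₂(ℤ/mℤ)`-invariant function `Φ_m : V(ℤ/mℤ) → ℂ`,
`ξ^±(s, Φ_m) = Σ_n a^±(Φ_m, n) n^{-s} := Σ_{x, ±Disc(x) > 0} |Stab(x)|⁻¹ Φ_m(x) |Disc(x)|^{-s}` (12)",
and (22): `h(n)` = the number of `GL₂(ℤ)`-orbits of discriminant `n`. This file DEFINES these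
objects as genuine mathematical objects (finite sums, thanks to `orbitsOfDisc_finite`) and proves
their basic well-definedness:

* `stabCard f = |Stab_{GL₂(ℤ)}(f)| = |Aut R(f)|`, an invariant of the orbit (`stabCard_eq_of_gl2zEquiv`);
* `shintaniCoeffWith w D := Σ_{O : orbit of disc D} w(O)/|Stab|` for an orbit-invariant weight `w`,
  in particular `a^±(n) = shintaniCoeff (±1) n` (`w = 1`) and `a^±(Φ_m, n)` (`w = Φ_m ∘ (mod m)`,
  `shintaniCoeffMod`);
* `shintaniZeta sgn s := LSeries (shintaniCoeff sgn) s` — **`ξ^±(s)`** as the formal Dirichlet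
  series `Σ_{n ≥ 1} a^±(n) n^{-s}` (Mathlib's `LSeries`; equal to the sum wherever it converges),
  and `shintaniZetaMod` — **`ξ^±(s, Φ_m)`**;
* `classNumber_eq` — `h(D) = #orbitsOfDisc D`, and `shintaniCoeffWith_one_le_classNumber` — `0 ≤ a^±(n) ≤ h(±n)`;
  `shintaniCoeffWith_eq_zero_of_emod_four`, `classNumber_eq_zero_of_emod_four` — zero unless `D ≡ 0, 1 (mod 4)`;
* `stabCard_le_three`, `one_le_stabCard` (irreducible `f`), `stabCard_reducibleNormalForm_eq_two` — the sizes
  of the weights (BTT (29)), from `StabilizerFinite.lean` and `ReducibleStabilizer.lean`.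

NOT here: Thm 2.4 (analytic continuation, functional equation, residues at `1` and `5/6` —
Shintani, Datskovsky–Wright, Taniguchi–Thorne), nor any convergence statement.

## References

* M. Bhargava, T. Taniguchi, F. Thorne, *Improved error estimates for the Davenport–Heilbronn
  theorems*, Math. Ann. 389 (2024) = arXiv:2107.12819, §2.4 (11), (12), (22) [BhargavaTaniguchiThorne2023].
* T. Shintani, *On Dirichlet series whose coefficients are class numbers of integral binary cubic
  forms*, J. Math. Soc. Japan 24 (1972).
-/

namespace Literature.NumberTheory.CubicFields

open BinaryCubic RingOfForm

/-! ### `|Stab(x)|`, an invariant of the orbit -/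

/-- `|Stab_{GL₂(ℤ)}(f)|`, the order of the stabilizer of `f` for the twisted action (8) (as a
`Nat.card`; it equals `|Aut R(f)|`, `stabCard_eq_card_ringAut`). [cite: BhargavaTaniguchiThorne2023, §2.4 (11) (the weights 1/|Stab(x)|)] -/
noncomputable def stabCard (f : BinaryCubic ℤ) : ℕ :=
  Nat.card (MulAction.stabilizer (GL (Fin 2) ℤ) f)

/-- `|Stab(f)| = |Aut R(f)|` (Levi–Delone–Faddeev, BTT Thm 2.1). [folklore] -/
theorem stabCard_eq_card_ringAut (f : BinaryCubic ℤ) : stabCard f = Nat.card (RingAut (RingOfForm f)) :=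
  card_stabilizer_eq_card_ringAut f

/-- Isomorphic rings have equinumerous automorphism groups (conjugation). [folklore] -/
def ringAutCongr {R S : Type*} [Mul R] [Add R] [Mul S] [Add S] (e : R ≃+* S) : RingAut R ≃ RingAut S where
  toFun σ := e.symm.trans (σ.trans e)
  invFun τ := e.trans (τ.trans e.symm)
  left_inv σ := by ext x; simp
  right_inv τ := by ext x; simp

/-- **`|Stab|` is an invariant of the `GL₂(ℤ)`-orbit.** [folklore] -/
theorem stabCard_eq_of_gl2zEquiv {f g : BinaryCubic ℤ} (h : GL2ZEquiv f g) : stabCard f = stabCard g := by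
  obtain ⟨e⟩ := nonempty_ringEquiv_of_gl2zEquiv h
  rw [stabCard_eq_card_ringAut, stabCard_eq_card_ringAut]
  exact Nat.card_congr (ringAutCongr e.symm)

/-! ### The coefficients `a^±(n)`, `a^±(Φ_m, n)` -/

/-- A representative form of an orbit of discriminant `D`. [folklore] -/
noncomputable def orbitRep {D : ℤ} (O : orbitsOfDisc D) : BinaryCubic ℤ :=
  O.2.choose

/-- The representative represents: `O = orbit(orbitRep O)` and `Disc(orbitRep O) = D`. [folklore] -/
theorem orbitRep_spec {D : ℤ} (O : orbitsOfDisc D) : O.1 = gl2zOrbit (orbitRep O) ∧ (orbitRep O).disc = D :=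
  O.2.choose_spec

/-- A form lies in the orbit of which it is a member's representative: `f ~ orbitRep ⟨orbit f, _⟩`. [folklore] -/
theorem gl2zEquiv_orbitRep (f : BinaryCubic ℤ) :
    GL2ZEquiv f (orbitRep (⟨gl2zOrbit f, f, rfl, rfl⟩ : orbitsOfDisc f.disc)) :=
  gl2zOrbit_eq_iff.mp (orbitRep_spec (⟨gl2zOrbit f, f, rfl, rfl⟩ : orbitsOfDisc f.disc)).1

/-- **The weighted orbit count** `Σ_{O : GL₂(ℤ)-orbit, Disc = D} w(O)/|Stab(O)|` for a weight `w` on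
forms (evaluated at the representative; meaningful for orbit-invariant `w`) — the coefficient of
`|D|^{-s}` in Shintani's series (BTT (11)–(12)). A finite sum for `D ≠ 0`; `0` for `D = 0` by the
`finsum` convention if infinite. [cite: BhargavaTaniguchiThorne2023, §2.4 (12) (the coefficients a^±(Φ_m, n))] -/
noncomputable def shintaniCoeffWith (w : BinaryCubic ℤ → ℂ) (D : ℤ) : ℂ :=
  ∑ᶠ O : orbitsOfDisc D, w (orbitRep O) / (stabCard (orbitRep O) : ℂ)

/-- **`a^±(n)`**: the number of `GL₂(ℤ)`-orbits of discriminant `±n`, each weighted by `1/|Stab|`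
(BTT (11): `ξ^±(s) = Σ_n a^±(n) n^{-s}`). [cite: BhargavaTaniguchiThorne2023, §2.4 (11) (ξ^±(s) = Σ |Stab(x)|⁻¹ |Disc(x)|^{-s})] -/
noncomputable def shintaniCoeff (sgn : ℤ) (n : ℕ) : ℂ :=
  shintaniCoeffWith (fun _ => 1) (sgn * n)

/-- **`a^±(Φ_m, n)`** for a function `Φ_m : V(ℤ/mℤ) → ℂ` (BTT (12)), with `x ↦ Φ_m(x mod m)`. [cite: BhargavaTaniguchiThorne2023, §2.4 (12) (a^±(Φ_m, n))] -/
noncomputable def shintaniCoeffMod {m : ℕ} (Φ : BinaryCubic (ZMod m) → ℂ) (sgn : ℤ) (n : ℕ) : ℂ :=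
  shintaniCoeffWith (fun f => Φ (f.map (Int.castRingHom (ZMod m)))) (sgn * n)

/-! ### The zeta functions `ξ^±(s)`, `ξ^±(s, Φ_m)` -/

/-- **Shintani's zeta function `ξ^±(s) = Σ_{x ∈ GL₂(ℤ)\V(ℤ), ±Disc(x) > 0} |Stab(x)|⁻¹ |Disc(x)|^{-s}
= Σ_{n ≥ 1} a^±(n) n^{-s}`** (BTT 2023, §2.4 (11)), as a formal Dirichlet series (Mathlib's
`LSeries`, the value of the series where it converges). `sgn = 1` gives `ξ⁺`, `sgn = −1` gives `ξ⁻`.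
[cite: BhargavaTaniguchiThorne2023, §2.4 (11) (Shintani's zeta functions ξ^±(s))] -/
noncomputable def shintaniZeta (sgn : ℤ) (s : ℂ) : ℂ :=
  LSeries (shintaniCoeff sgn) s

/-- **`ξ^±(s, Φ_m) = Σ_n a^±(Φ_m, n) n^{-s}`** (BTT 2023, §2.4 (12)). [cite: BhargavaTaniguchiThorne2023, §2.4 (12) (ξ^±(s, Φ_m))] -/
noncomputable def shintaniZetaMod {m : ℕ} (Φ : BinaryCubic (ZMod m) → ℂ) (sgn : ℤ) (s : ℂ) : ℂ :=
  LSeries (shintaniCoeffMod Φ sgn) s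

/-- `ξ^±(s, 1) = ξ^±(s)`: the trivial weight recovers (11) from (12). [folklore] -/
theorem shintaniZetaMod_one {m : ℕ} (sgn : ℤ) : shintaniZetaMod (fun _ : BinaryCubic (ZMod m) => (1 : ℂ)) sgn = shintaniZeta sgn := rfl

/-! ### Basic properties -/

/-- `h(D)` is the number of orbits of discriminant `D` (BTT (22)), as the cardinality of the finite
set `orbitsOfDisc D`. [folklore] -/
theorem classNumber_eq (D : ℤ) : classNumber D = Nat.card (orbitsOfDisc D) := rfl

/-- With the trivial weight, `a(D) = Σ_{orbits of disc D} 1/|Stab|`. [folklore] -/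
theorem shintaniCoeffWith_one (D : ℤ) :
    shintaniCoeffWith (fun _ => 1) D = ∑ᶠ O : orbitsOfDisc D, ((stabCard (orbitRep O) : ℂ))⁻¹ := by
  simp [shintaniCoeffWith]

/-- `1 ≤ |Stab(f)|` always fails only for infinite stabilizers: `|Stab(f)|` as `Nat.card` is `0` iff
the stabilizer is infinite; in any case `0 ≤ 1/|Stab| ≤ 1`. [folklore] -/
theorem inv_stabCard_le_one (f : BinaryCubic ℤ) : ((stabCard f : ℝ))⁻¹ ≤ 1 := by
  rcases Nat.eq_zero_or_pos (stabCard f) with h | h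
  · rw [h]; simp
  · exact inv_le_one_of_one_le₀ (by exact_mod_cast h)

/-- **`0 ≤ a(D) ≤ h(D)`**: the weighted count is real, nonnegative and at most the number of orbits
(for `D ≠ 0`). [folklore] -/
theorem shintaniCoeffWith_one_le_classNumber {D : ℤ} (hD : D ≠ 0) :
    ∃ r : ℝ, shintaniCoeffWith (fun _ => 1) D = r ∧ 0 ≤ r ∧ r ≤ classNumber D := by
  haveI := finite_orbitsOfDisc hD
  haveI : Fintype (orbitsOfDisc D) := Fintype.ofFinite _
  refine ⟨∑ O : orbitsOfDisc D, ((stabCard (orbitRep O) : ℝ))⁻¹, ?_, ?_, ?_⟩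
  · rw [shintaniCoeffWith_one, finsum_eq_sum_of_fintype]
    push_cast
    rfl
  · exact Finset.sum_nonneg fun O _ => by positivity
  · calc ∑ O : orbitsOfDisc D, ((stabCard (orbitRep O) : ℝ))⁻¹ ≤ ∑ _O : orbitsOfDisc D, (1 : ℝ) :=
          Finset.sum_le_sum fun O _ => inv_stabCard_le_one _
      _ = classNumber D := by
          rw [Finset.sum_const, Finset.card_univ, nsmul_eq_mul, mul_one, classNumber, Nat.card_eq_fintype_card]

/-- `a(D) = 0` when there is no form of discriminant `D` (e.g. `D ≡ 2, 3 (mod 4)`). [folklore] -/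
theorem shintaniCoeffWith_eq_zero_of_isEmpty (w : BinaryCubic ℤ → ℂ) {D : ℤ} (h : ∀ f : BinaryCubic ℤ, f.disc ≠ D) :
    shintaniCoeffWith w D = 0 := by
  haveI : IsEmpty (orbitsOfDisc D) := ⟨fun ⟨O, f, _, hf⟩ => h f hf⟩
  rw [shintaniCoeffWith, finsum_of_isEmpty]

/-- **`a(D) = 0` unless `D ≡ 0, 1 (mod 4)`** (the discriminant of a binary cubic form is
`≡ 0, 1 (mod 4)`, `disc_emod_four`). [folklore] -/
theorem shintaniCoeffWith_eq_zero_of_emod_four (w : BinaryCubic ℤ → ℂ) {D : ℤ} (hD : D % 4 = 2 ∨ D % 4 = 3) :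
    shintaniCoeffWith w D = 0 :=
  shintaniCoeffWith_eq_zero_of_isEmpty w fun f hf => by
    rcases disc_emod_four f with h | h <;> omega

/-- … and `h(D) = 0` unless `D ≡ 0, 1 (mod 4)`. [folklore] -/
theorem classNumber_eq_zero_of_emod_four {D : ℤ} (hD : D % 4 = 2 ∨ D % 4 = 3) : classNumber D = 0 := by
  haveI : IsEmpty (orbitsOfDisc D) :=
    ⟨fun ⟨O, f, _, hf⟩ => by rcases disc_emod_four f with h | h <;> omega⟩
  exact Nat.card_of_isEmpty

/-! ### The size of the weights `1/|Stab|` (BTT (29)) -/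

/-- **`1 ≤ |Stab(f)| ≤ 3` for irreducible `f`** (`StabilizerFinite`): the Shintani weight of an
irreducible orbit is `1` or `1/3` (`1/2` being excluded by `|Aut K| ∣ 3`… here only the bounds). [folklore] -/
theorem stabCard_le_three {f : BinaryCubic ℤ} (hf : f.IsIrreducible) : stabCard f ≤ 3 := by
  haveI : Fact f.IsIrreducible := ⟨hf⟩
  exact card_stabilizer_le_three

/-- `1 ≤ |Stab(f)|` for irreducible `f` (the stabilizer is finite and nonempty). [folklore] -/
theorem one_le_stabCard {f : BinaryCubic ℤ} (hf : f.IsIrreducible) : 1 ≤ stabCard f := by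
  haveI : Fact f.IsIrreducible := ⟨hf⟩
  exact one_le_card_stabilizer

/-- **`|Stab| = 2` for the maximal reducible forms `(0, 1, c, d)` of fundamental discriminant**
(`ReducibleStabilizer`; BTT (29): weight `1/2` for `ℤ × 𝓞_F`). [folklore] -/
theorem stabCard_reducibleNormalForm_eq_two {c d : ℤ}
    (hD : ((c ^ 2 - 4 * d) % 4 = 1 ∧ Squarefree (c ^ 2 - 4 * d) ∧ c ^ 2 - 4 * d ≠ 1) ∨
      (4 ∣ c ^ 2 - 4 * d ∧ ((c ^ 2 - 4 * d) / 4 % 4 = 2 ∨ (c ^ 2 - 4 * d) / 4 % 4 = 3) ∧ Squarefree ((c ^ 2 - 4 * d) / 4))) :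
    stabCard (⟨0, 1, c, d⟩ : BinaryCubic ℤ) = 2 :=
  card_stabilizer_eq_two_of_isFundamental hD

end Literature.NumberTheory.CubicFields
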